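import Summits.CriticalPhenomena.PercolationContinuityZ3.Theorems.PercNearOneGluingNoHeavyLowerTailSahiChordCoordinate
import Summits.CriticalPhenomena.PercolationContinuityZ3.Theorems.PercNearOneGluingNoHeavyLowerTailSahiCoordinateTwoThirdsFalse
import Mathlib.Tactic.Linarith
import Mathlib.Tactic.NormNum
import Mathlib.Tactic.FinCases
import HarnessLib

/-!
# `NoHeavyLowerTail` (stmt-CriticalPhenomena-4575), P2: the CHORD hypotheses of `…SahiChordCoordinate` are UNSATISFIABLE (part 1:
# the instance — a prime CORE triple on six coins under the uniform measure — its structural facts, and `E₃ = 71/32768`)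

Support file (seat `prim-masterthm-p2`, gen 15; `--supports stmt-CriticalPhenomena-4575`).  No `sorry`, no named facts, standard axioms.
Memo SAHI-ROUTE.md §4.39.  It settles, in the negative and in THIS lane's vocabulary (`bernoulliWeight`, `secAt`, `esupp`), the hypotheses of
gen 14's reductions `SahiClassTCube.masterFamilyNonneg_three_of_chord` and `…_of_core_chord` (p311319): "every triple with an essential
coordinate / every CORE triple has, at every `p`, an essential `e` with `(1−p_e)·E₃(U^{e←0}) + p_e·E₃(U^{e←1}) ≤ E₃(U)`" (criterion `(B∃)`,
SAHI-ROUTE §4.38) — both reductions stand, vacuously.  (The same mathematical statement without the core clause, in the `Fin k → Bool`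
vocabulary, is prim-l12-p5's `SahiChordSuperlinear.ChordSuperlinear`, refuted 2026-08-20 by `not_chordSuperlinear_five` with the doubled
star-α at `q ≡ 2/3`; the witness below is prim-l12-p5's PRIME "augmented block star" (P5-REPORT §3h(c)), which is bad already at `q ≡ 1/2`.)

WITNESS.  `ι = Fin 6`, blocks `{0,1}, {2,3}, {4,5}`, `p ≡ ½`;
  `A = x₀x₁ ∨ (x₀∨x₁)(x₂∨x₃∨x₄∨x₅)`,  `B = x₂x₃ ∨ (x₂∨x₃)(x₀∨x₁∨x₄∨x₅)`,  `C = x₄x₅ ∨ (x₄∨x₅)(x₀∨x₁∨x₂∨x₃)`.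
Counts (of 64): `|A| = |B| = |C| = 46`, pairwise `36`, triple `27`, so `E₃ = 71/32768`; for EVERY coordinate `e`: the `e ← 1` sections
(`30 → 62, 44 → 48, …`) have `E₃ = 0` (two independent tops `x₂∨x₃`, `x₄∨x₅` next to a third), the `e ← 0` sections have `E₃ = 39/8192`, so the
chord value is `39/16384 = 78/32768 > 71/32768 = E₃` (`sahiE_three_aug` here; the twelve section values `sahiE_three_sec_*` and the two
refutations `not_chord_hypothesis` / `not_core_chord_hypothesis` are in the companion file `…SahiChordCoordinateRefuted`, split off for
the 400-line limit).  The triple is a CORE triple: every coordinate is essential for all three members (`affects_aug`), none is canalyzing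
(`{e}` lies in no member, `{e}ᶜ` in every member: `not_canalyzing_aug`).  By SAHI-ROUTE §4.39(a) the `p_e`-free strengthening CORE-AXIS-CONVEX
dies with it.  Technique: events defined through Boolean forms `PA/PB/PC` of the bit vector, so that memberships of coded points `pt 6 j`
and of their forcings (`bits_forceAt` = `Function.update`) are definitional and all counts are `decide` computations over `j < 64`
(template: `…SahiCoordinateTwoThirdsFalse`).
HONEST FRAMING: a census-born criterion of this programme is closed negatively by a kernel-checked finite computation; Kahn's Conjecture 5 /
Sahi's `C₃`, BGC-all and the `λ = 2` rung are NOT affected (`M⁺, M⁻ > 0` on this triple), nor is the DT-restricted `SahiCoordinateInduction.DTEGCWeak`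
(the witness is not doubly terminal: `{x₀}` is a frontier point of `A` outside `B`). [this work]
-/

noncomputable section

open scoped Classical

namespace Summit.CriticalPhenomena.PercolationContinuityZ3.Theorems

namespace SahiChordCoordinateRefuted

open Finset Literature.Combinatorics.Sahi2008
open Literature.Probability.Percolation.DecisionTree (ind ind_of_mem ind_of_not_mem)
open SahiC3Cube (pt)
open Literature.Probability.Percolation (half coe_half)
open SahiCoordinateTwoThirdsFalse (ind_eq_ite)

/-! ### 1. The instance -/

/-- Boolean form of `A = x₀x₁ ∨ (x₀∨x₁)(x₂∨x₃∨x₄∨x₅)`. [this work] -/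
def PA (β : Fin 6 → Bool) : Bool := (β 0 && β 1) || ((β 0 || β 1) && (β 2 || β 3 || β 4 || β 5))
/-- Boolean form of `B = x₂x₃ ∨ (x₂∨x₃)(x₀∨x₁∨x₄∨x₅)`. [this work] -/
def PB (β : Fin 6 → Bool) : Bool := (β 2 && β 3) || ((β 2 || β 3) && (β 0 || β 1 || β 4 || β 5))
/-- Boolean form of `C = x₄x₅ ∨ (x₄∨x₅)(x₀∨x₁∨x₂∨x₃)`. [this work] -/
def PC (β : Fin 6 → Bool) : Bool := (β 4 && β 5) || ((β 4 || β 5) && (β 0 || β 1 || β 2 || β 3))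
/-- The bit vector of a configuration. [this work] -/
def bits (ω : Set (Fin 6)) : Fin 6 → Bool := fun i => decide (i ∈ ω)
/-- The event `A`. [this work] -/
def augA : Set (Set (Fin 6)) := {ω | PA (bits ω) = true}
/-- The event `B`. [this work] -/
def augB : Set (Set (Fin 6)) := {ω | PB (bits ω) = true}
/-- The event `C`. [this work] -/
def augC : Set (Set (Fin 6)) := {ω | PC (bits ω) = true}
/-- The triple `U = (A, B, C)`. [this work] -/
def augU : Fin 3 → Set (Set (Fin 6)) := ![augA, augB, augC]
/-- `p ≡ ½`. [this work] -/
def pH : Fin 6 → unitInterval := fun _ => half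

/-- The common shape of the three members is monotone in its six inputs. [this work] -/
theorem shape_mono {x0 x1 x2 x3 x4 x5 y0 y1 y2 y3 y4 y5 : Prop} (h0 : x0 → y0) (h1 : x1 → y1) (h2 : x2 → y2)
    (h3 : x3 → y3) (h4 : x4 → y4) (h5 : x5 → y5) :
    (x0 ∧ x1 ∨ (x0 ∨ x1) ∧ (x2 ∨ x3 ∨ x4 ∨ x5)) → (y0 ∧ y1 ∨ (y0 ∨ y1) ∧ (y2 ∨ y3 ∨ y4 ∨ y5)) := by
  tauto

/-- Membership in `A`, propositionally. [this work] -/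
theorem mem_augA (ω : Set (Fin 6)) : ω ∈ augA ↔
    ((0 : Fin 6) ∈ ω ∧ (1 : Fin 6) ∈ ω ∨ ((0 : Fin 6) ∈ ω ∨ (1 : Fin 6) ∈ ω) ∧
      ((2 : Fin 6) ∈ ω ∨ (3 : Fin 6) ∈ ω ∨ (4 : Fin 6) ∈ ω ∨ (5 : Fin 6) ∈ ω)) := by
  simp [augA, PA, bits, or_assoc]

/-- Membership in `B`, propositionally. [this work] -/
theorem mem_augB (ω : Set (Fin 6)) : ω ∈ augB ↔
    ((2 : Fin 6) ∈ ω ∧ (3 : Fin 6) ∈ ω ∨ ((2 : Fin 6) ∈ ω ∨ (3 : Fin 6) ∈ ω) ∧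
      ((0 : Fin 6) ∈ ω ∨ (1 : Fin 6) ∈ ω ∨ (4 : Fin 6) ∈ ω ∨ (5 : Fin 6) ∈ ω)) := by
  simp [augB, PB, bits, or_assoc]

/-- Membership in `C`, propositionally. [this work] -/
theorem mem_augC (ω : Set (Fin 6)) : ω ∈ augC ↔
    ((4 : Fin 6) ∈ ω ∧ (5 : Fin 6) ∈ ω ∨ ((4 : Fin 6) ∈ ω ∨ (5 : Fin 6) ∈ ω) ∧
      ((0 : Fin 6) ∈ ω ∨ (1 : Fin 6) ∈ ω ∨ (2 : Fin 6) ∈ ω ∨ (3 : Fin 6) ∈ ω)) := by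
  simp [augC, PC, bits, or_assoc]

/-- All three events are up-sets. [this work] -/
theorem isUpperSet_augU : ∀ j, IsUpperSet (augU j) := by
  intro j; fin_cases j
  · exact fun ω ω' hle hω => (mem_augA ω').2 (shape_mono (fun h => hle h) (fun h => hle h) (fun h => hle h)
      (fun h => hle h) (fun h => hle h) (fun h => hle h) ((mem_augA ω).1 hω))
  · exact fun ω ω' hle hω => (mem_augB ω').2 (shape_mono (fun h => hle h) (fun h => hle h) (fun h => hle h)
      (fun h => hle h) (fun h => hle h) (fun h => hle h) ((mem_augB ω).1 hω))
  · exact fun ω ω' hle hω => (mem_augC ω').2 (shape_mono (fun h => hle h) (fun h => hle h) (fun h => hle h)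
      (fun h => hle h) (fun h => hle h) (fun h => hle h) ((mem_augC ω).1 hω))

/-- Every coordinate affects every member: witnesses `∅ ∉ U_j ∌ {x}` … concretely, `{y} ∉ U_j` and `{y, x} ∈ U_j` for a suitable `y`.
[this work] -/
theorem affects_aug : ∀ (j : Fin 3) (x : Fin 6), x ∈ esupp (augU j) := by
  intro j x
  rw [mem_esupp, affects_iff]
  fin_cases j <;> fin_cases x
  · exact ⟨{1}, by simp [augU, mem_augA], by simp [augU, mem_augA]⟩
  · exact ⟨{0}, by simp [augU, mem_augA], by simp [augU, mem_augA]⟩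
  · exact ⟨{0}, by simp [augU, mem_augA], by simp [augU, mem_augA]⟩
  · exact ⟨{0}, by simp [augU, mem_augA], by simp [augU, mem_augA]⟩
  · exact ⟨{0}, by simp [augU, mem_augA], by simp [augU, mem_augA]⟩
  · exact ⟨{0}, by simp [augU, mem_augA], by simp [augU, mem_augA]⟩
  · exact ⟨{2}, by simp [augU, mem_augB], by simp [augU, mem_augB]⟩
  · exact ⟨{2}, by simp [augU, mem_augB], by simp [augU, mem_augB]⟩
  · exact ⟨{3}, by simp [augU, mem_augB], by simp [augU, mem_augB]⟩
  · exact ⟨{2}, by simp [augU, mem_augB], by simp [augU, mem_augB]⟩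
  · exact ⟨{2}, by simp [augU, mem_augB], by simp [augU, mem_augB]⟩
  · exact ⟨{2}, by simp [augU, mem_augB], by simp [augU, mem_augB]⟩
  · exact ⟨{4}, by simp [augU, mem_augC], by simp [augU, mem_augC]⟩
  · exact ⟨{4}, by simp [augU, mem_augC], by simp [augU, mem_augC]⟩
  · exact ⟨{4}, by simp [augU, mem_augC], by simp [augU, mem_augC]⟩
  · exact ⟨{4}, by simp [augU, mem_augC], by simp [augU, mem_augC]⟩
  · exact ⟨{5}, by simp [augU, mem_augC], by simp [augU, mem_augC]⟩
  · exact ⟨{4}, by simp [augU, mem_augC], by simp [augU, mem_augC]⟩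

/-- No coordinate is canalyzing: `{x} ∉ U_j` (so `{x ∈ ω} ⊄ U_j`) and `{x}ᶜ ∈ U_j` (so `U_j ⊄ {x ∈ ω}`). [this work] -/
theorem not_canalyzing_aug : ∀ (j : Fin 3) (x : Fin 6),
    ¬ ({ω : Set (Fin 6) | x ∈ ω} ⊆ augU j) ∧ ¬ (augU j ⊆ {ω : Set (Fin 6) | x ∈ ω}) := by
  intro j x
  constructor
  · intro h
    have hx : ({x} : Set (Fin 6)) ∈ augU j := h (show x ∈ ({x} : Set (Fin 6)) by simp)
    fin_cases j <;> fin_cases x <;> simp [augU, mem_augA, mem_augB, mem_augC] at hx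
  · intro h
    have hmem : (({x} : Set (Fin 6))ᶜ) ∈ augU j := by
      fin_cases j <;> fin_cases x <;> simp [augU, mem_augA, mem_augB, mem_augC]
    have hx : x ∈ (({x} : Set (Fin 6))ᶜ) := h hmem
    simp at hx

/-! ### 2. Expectations under the uniform weight as sums over the 64 codes -/

/-- Under `p ≡ ½` every configuration has weight `1/64`. [this work] -/
theorem weight_pH (ω : Set (Fin 6)) : bernoulliWeight pH ω = 1 / 64 := by
  show (∏ e : Fin 6, if e ∈ ω then ((pH e : unitInterval) : ℝ) else 1 - ((pH e : unitInterval) : ℝ)) = 1 / 64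
  have h : ∀ e : Fin 6, (if e ∈ ω then ((pH e : unitInterval) : ℝ) else 1 - ((pH e : unitInterval) : ℝ)) = 1 / 2 := by
    intro e; simp only [pH, coe_half]; split_ifs <;> norm_num
  rw [Finset.prod_congr rfl fun e _ => h e, Finset.prod_const, Finset.card_univ, Fintype.card_fin]
  norm_num

/-- Expectation under `p ≡ ½` as a sum over the codes `j < 64`. [this work] -/
theorem ex_pH (F : Set (Fin 6) → ℝ) :
    ex (bernoulliWeight pH) F = (1 / 64) * ∑ j ∈ Finset.range 64, F (pt 6 j) := by
  rw [ex_def]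
  have h1 : (∑ x : Set (Fin 6), bernoulliWeight pH x * F x) = ∑ x : Set (Fin 6), (1 / 64) * F x :=
    Finset.sum_congr rfl fun x _ => by rw [weight_pH]
  rw [h1, SahiTransportJR.sum_eq_sum_range (m := 6) (fun x => (1 / 64 : ℝ) * F x), ← Finset.mul_sum]
  norm_num

/-- Bits of a coded point. [this work] -/
theorem bits_pt (j : ℕ) : bits (pt 6 j) = fun i : Fin 6 => j.testBit i := by
  funext i; simp [bits, pt]

/-- Forcing a coordinate updates one bit. [this work] -/
theorem bits_forceAt (e : Fin 6) (b : Bool) (ω : Set (Fin 6)) : bits (forceAt e b ω) = Function.update (bits ω) e b := by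
  funext i
  by_cases hi : i = e
  · subst hi
    cases b <;> simp [bits, forceAt]
  · rw [Function.update_of_ne hi]
    cases b <;> simp [bits, forceAt, hi]

/-- Indicator of `A` on a coded point. [this work] -/
theorem indA_pt (j : ℕ) : ind augA (pt 6 j) = if PA (fun i : Fin 6 => j.testBit i) = true then 1 else 0 :=
  ind_eq_ite _ _ _ (by show PA (bits (pt 6 j)) = true ↔ _; rw [bits_pt])

/-- Indicator of `B` on a coded point. [this work] -/
theorem indB_pt (j : ℕ) : ind augB (pt 6 j) = if PB (fun i : Fin 6 => j.testBit i) = true then 1 else 0 :=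
  ind_eq_ite _ _ _ (by show PB (bits (pt 6 j)) = true ↔ _; rw [bits_pt])

/-- Indicator of `C` on a coded point. [this work] -/
theorem indC_pt (j : ℕ) : ind augC (pt 6 j) = if PC (fun i : Fin 6 => j.testBit i) = true then 1 else 0 :=
  ind_eq_ite _ _ _ (by show PC (bits (pt 6 j)) = true ↔ _; rw [bits_pt])

/-- Indicator of a section of `A` on a coded point. [this work] -/
theorem indA_sec_pt (e : Fin 6) (b : Bool) (j : ℕ) :
    ind (secAt e b augA) (pt 6 j) = if PA (Function.update (fun i : Fin 6 => j.testBit i) e b) = true then 1 else 0 :=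
  ind_eq_ite _ _ _ (by rw [mem_secAt]; show PA (bits (forceAt e b (pt 6 j))) = true ↔ _; rw [bits_forceAt, bits_pt])

/-- Indicator of a section of `B` on a coded point. [this work] -/
theorem indB_sec_pt (e : Fin 6) (b : Bool) (j : ℕ) :
    ind (secAt e b augB) (pt 6 j) = if PB (Function.update (fun i : Fin 6 => j.testBit i) e b) = true then 1 else 0 :=
  ind_eq_ite _ _ _ (by rw [mem_secAt]; show PB (bits (forceAt e b (pt 6 j))) = true ↔ _; rw [bits_forceAt, bits_pt])

/-- Indicator of a section of `C` on a coded point. [this work] -/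
theorem indC_sec_pt (e : Fin 6) (b : Bool) (j : ℕ) :
    ind (secAt e b augC) (pt 6 j) = if PC (Function.update (fun i : Fin 6 => j.testBit i) e b) = true then 1 else 0 :=
  ind_eq_ite _ _ _ (by rw [mem_secAt]; show PC (bits (forceAt e b (pt 6 j))) = true ↔ _; rw [bits_forceAt, bits_pt])

/-- The family of indicators of `U` as a triple. [this work] -/
theorem ind_augU : (fun j => ind (augU j)) = ![ind augA, ind augB, ind augC] := by
  funext j; fin_cases j <;> rfl

/-- The family of indicators of the `e ← b` sections as a triple. [this work] -/
theorem ind_sec_augU (e : Fin 6) (b : Bool) :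
    (fun j => ind (secAt e b (augU j))) = ![ind (secAt e b augA), ind (secAt e b augB), ind (secAt e b augC)] := by
  funext j; fin_cases j <;> rfl

/-- Seven counts for the triple itself over the 64 codes (kernel computation). [this work] -/
theorem counts_base :
    #{j ∈ Finset.range 64 | PA (fun i : Fin 6 => j.testBit i) = true} = 46 ∧
    #{j ∈ Finset.range 64 | PB (fun i : Fin 6 => j.testBit i) = true} = 46 ∧
    #{j ∈ Finset.range 64 | PC (fun i : Fin 6 => j.testBit i) = true} = 46 ∧
    #{j ∈ Finset.range 64 | ((PA (fun i : Fin 6 => j.testBit i) && PB (fun i : Fin 6 => j.testBit i)) && PC (fun i : Fin 6 => j.testBit i)) = true} = 27 ∧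
    #{j ∈ Finset.range 64 | (PB (fun i : Fin 6 => j.testBit i) && PC (fun i : Fin 6 => j.testBit i)) = true} = 36 ∧
    #{j ∈ Finset.range 64 | (PA (fun i : Fin 6 => j.testBit i) && PC (fun i : Fin 6 => j.testBit i)) = true} = 36 ∧
    #{j ∈ Finset.range 64 | (PA (fun i : Fin 6 => j.testBit i) && PB (fun i : Fin 6 => j.testBit i)) = true} = 36 := by
  decide

/-- **`E₃(μ_½; U) = 71 / 32768`.** [this work] -/
theorem sahiE_three_aug : sahiE (bernoulliWeight pH) 3 (fun i => ind (augU i)) = 71 / 32768 := by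
  rw [ind_augU, sahiE_three]
  simp only [ex_pH, Pi.mul_apply, indA_pt, indB_pt, indC_pt, SahiCoordinateTwoThirdsFalse.ite_mul_ite, Finset.sum_boole]
  obtain ⟨h1, h2, h3, h4, h5, h6, h7⟩ := counts_base
  rw [h1, h2, h3, h4, h5, h6, h7]
  norm_num

end SahiChordCoordinateRefuted

end Summit.CriticalPhenomena.PercolationContinuityZ3.Theorems
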